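import Summits.Ventures.WeilGRH.ChristoffelCertificateCheck
import HarnessLib

/-!
# rh-explicit (venture WeilGRH): CHRISTOFFEL CERTIFICATES, III — soundness of the multiplicity checker
  `Christoffel.checkCertMul` (block mass `< M`; at most `M − 1` lines of an ℕ-valued Weil measure in a block)

Cell `rh-explicit`, WEIL TRACK (structure seat weil-3, gen16).  Continuation of `ChristoffelCertificateCheck.lean`.
`Christoffel.checkCertMul … M` accepts iff the form box lies strictly below `M` times every piece's profile box; then
(`measureReal_Icc_lt_of_checkCertMul`) `μ[p/q, p'/q] < M` for every positive measure representing Weil's form on the tests of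
`[-a, a]` (by `blockMass_le_gramForm`), and (`exists_nat_lt_of_natValued_of_checkCertMul`) an ℕ-valued one carries at most
`M − 1` unit masses there — the «at most one line per window» certificates of the rung files `RigidityWindows*`.
RH-free; proofs only; standard axioms; nothing here bears on the truth of RH.
-/

set_option autoImplicit false

noncomputable section

open Complex Set MeasureTheory
open scoped Real ENNReal

namespace Summit.Ventures.WeilGRH

open Literature.NumberTheory.LFunctions
open Literature.NumberTheory.LFunctions.Yoshida1992 (chi gramCoeff freq PrimeLen PrimeData)
open Literature.NumberTheory.LFunctions.Yoshida1992.Encl (Consts IdxRec ConstsValid OffValid DiagValid IdxValid TabValid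
  tget gramBox mem_gramBox sgn neg_one_zpow_eq_sgn mem_of_eq)
open Literature.Analysis.ValidatedNumerics.NumericsMP (MI MC)
open Summit.RiemannHypothesis.RiemannHypothesis.Theorems.WeilFormatC
open Summit.RiemannHypothesis.RiemannHypothesis.Theorems.WeilBochnerMeasure (weilMellin_sum_smul_chi)

variable {a : ℝ}

namespace Christoffel

variable {S : ℕ} {ks : List PrimeLen} {C : Consts} {tab : List IdxRec} {Nt : ℕ}

/-- **Soundness of the multiplicity checker**: if `checkCertMul … M` accepts, every Weil measure of the rung has mass `< M` on
the block. -/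
theorem measureReal_Icc_lt_of_checkCertMul {S : ℕ} (hS : 0 < S) (ha0 : 0 < a) (hks : PrimeData a ks)
    (hC : ConstsValid S a ks C) (htab : TabValid S a ks Nt tab) {N : ℕ} (hN : N < Nt) {Kt kr yT : ℕ} {c : List ℤ}
    {p p' : ℤ} {q K M : ℕ} (h : checkCertMul S Kt kr yT C tab N c p p' q K M = true) {μ : Measure ℝ}
    (hμ : ∀ g : ℝ → ℂ, IsWeilTest g → tsupport g ⊆ Icc (-a) a →
      Integrable (fun t : ℝ ↦ ‖weilMellin g (1 / 2 + t * I)‖ ^ 2) μ ∧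
        weilQuadratic g = ((∫ t, ‖weilMellin g (1 / 2 + t * I)‖ ^ 2 ∂μ : ℝ) : ℂ)) :
    μ.real (Icc ((p : ℝ) / q) ((p' : ℝ) / q)) < M := by
  unfold checkCertMul at h
  simp only [Bool.and_eq_true, decide_eq_true_eq, List.all_eq_true, List.mem_range] at h
  obtain ⟨⟨⟨hq, hK⟩, hM⟩, hall⟩ := h
  have hSr : (0 : ℝ) < S := by exact_mod_cast hS
  have hMr : (0 : ℝ) < M := by exact_mod_cast hM
  set F := formBox S C tab N c (2 * N + 1) with hF
  -- the form is `≤ F.hi/S` and `≥ 0`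
  have hform := mem_formBox hS ha0 hks hC htab hN c (2 * N + 1) le_rfl
  have e : ∑ n ∈ modes N, ∑ k ∈ modes N, coefFun N c n * coefFun N c k * gramCoeff a n k =
      ∑ i ∈ Finset.range (2 * N + 1), ∑ j ∈ Finset.range (2 * N + 1),
        gramCoeff a (mode N i) (mode N j) * ((coefAt c i * coefAt c j : ℤ) : ℝ) := by
    unfold modes
    rw [Finset.sum_image (mode_injOn N)]
    refine Finset.sum_congr rfl fun i _ ↦ ?_
    rw [Finset.sum_image (mode_injOn N)]
    refine Finset.sum_congr rfl fun j _ ↦ ?_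
    rw [coefFun_mode, coefFun_mode]
    push_cast
    ring
  have hle : ∑ n ∈ modes N, ∑ k ∈ modes N, coefFun N c n * coefFun N c k * gramCoeff a n k ≤ (F.hi : ℝ) / S := by
    rw [e]; exact MI.le_hi_div hS hform
  have h0 : 0 ≤ ∑ n ∈ modes N, ∑ k ∈ modes N, coefFun N c n * coefFun N c k * gramCoeff a n k :=
    gramForm_nonneg_of_represents ha0 hμ (modes N) (coefFun N c)
  -- the floor `m = (F.hi + ½)/(M S)` is below the profile on the block
  set m : ℝ := ((F.hi : ℝ) + 1 / 2) / (M * S) with hm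
  have hm0 : 0 < m := by
    have : (0 : ℝ) ≤ F.hi := by
      have := h0.trans hle
      exact_mod_cast (div_nonneg_iff.1 this).elim (fun h ↦ h.1) (fun h ↦ absurd hSr (not_lt.2 h.2))
    positivity
  have hprof : ∀ t ∈ Icc ((p : ℝ) / q) ((p' : ℝ) / q),
      m ≤ ‖weilMellin (∑ n ∈ modes N, (coefFun N c n : ℂ) • chi a n) (1 / 2 + t * I)‖ ^ 2 := by
    intro t ht
    obtain ⟨k, hk, h1, h2⟩ := exists_piece hq hK ht
    have hT := mem_pieceBox S hq hK k h1 h2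
    have hTc : MI.mem S (((p * (2 * (K : ℤ) - 2 * k - 1) + p' * (2 * k + 1) : ℤ) : ℝ) / ((2 * q * K : ℕ) : ℝ))
        (pieceCentre S p p' q K k) := MI.mem_ofFrac S _ (by positivity)
    have hk' := hall k hk
    split at hk'
    · rename_i P hP
      simp only [decide_eq_true_eq] at hk'
      have hpr := le_profile_of_profBox hS ha0 hC htab hN c hT hTc hP
      have ee : ‖weilMellin (∑ n ∈ modes N, (coefFun N c n : ℂ) • chi a n) (1 / 2 + t * I)‖ ^ 2 =
          2 * a * (∑ j ∈ Finset.range (2 * N + 1),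
            ((coefAt c j : ℤ) : ℝ) * Real.sinc (a * t + π * (mode N j))) ^ 2 := by
        rw [norm_sq_weilMellin_sum_smul_chi_eq_sinc ha0]
        unfold modes
        rw [Finset.sum_image (mode_injOn N)]
        congr 2
        refine Finset.sum_congr rfl fun j _ ↦ ?_
        rw [coefFun_mode]
      rw [ee]
      refine le_trans ?_ hpr
      have hint : (F.hi : ℝ) + 1 ≤ (M : ℝ) * (P.lo : ℝ) := by exact_mod_cast hk'
      rw [hm, div_le_div_iff₀ (by positivity) hSr]
      nlinarith
    · simp at hk'
  have hmass := blockMass_le_gramForm ha0 hμ (modes N) (coefFun N c) hprof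
  -- `m · μ ≤ form ≤ F.hi/S < M m`
  have hlt : (F.hi : ℝ) / S < M * m := by
    rw [hm, mul_div_assoc']
    rw [div_lt_div_iff₀ hSr (by positivity)]
    nlinarith
  have : m * μ.real (Icc ((p : ℝ) / q) ((p' : ℝ) / q)) < m * M := by
    calc m * μ.real (Icc ((p : ℝ) / q) ((p' : ℝ) / q)) ≤ (F.hi : ℝ) / S := hmass.trans hle
      _ < M * m := hlt
      _ = m * M := mul_comm _ _
  exact lt_of_mul_lt_mul_left this hm0.le

/-- ★ **AT MOST `M − 1` LINES**: if `checkCertMul … M` accepts, every ℕ-valued Weil measure of the rung has an integer mass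
`k < M` on the block (for `M = 2`: at most ONE line there). -/
theorem exists_nat_lt_of_natValued_of_checkCertMul {S : ℕ} (hS : 0 < S) (ha0 : 0 < a) (hks : PrimeData a ks)
    (hC : ConstsValid S a ks C) (htab : TabValid S a ks Nt tab) {N : ℕ} (hN : N < Nt) {Kt kr yT : ℕ} {c : List ℤ}
    {p p' : ℤ} {q K M : ℕ} (h : checkCertMul S Kt kr yT C tab N c p p' q K M = true) {μ : Measure ℝ}
    (hμ : ∀ g : ℝ → ℂ, IsWeilTest g → tsupport g ⊆ Icc (-a) a →
      Integrable (fun t : ℝ ↦ ‖weilMellin g (1 / 2 + t * I)‖ ^ 2) μ ∧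
        weilQuadratic g = ((∫ t, ‖weilMellin g (1 / 2 + t * I)‖ ^ 2 ∂μ : ℝ) : ℂ))
    (hNv : ∀ s : Set ℝ, MeasurableSet s → Bornology.IsBounded s → ∃ k : ℕ, μ.real s = k) :
    ∃ k : ℕ, k < M ∧ μ.real (Icc ((p : ℝ) / q) ((p' : ℝ) / q)) = k := by
  obtain ⟨k, hk⟩ := hNv _ measurableSet_Icc (Metric.isBounded_Icc _ _)
  refine ⟨k, ?_, hk⟩
  have h1 := measureReal_Icc_lt_of_checkCertMul hS ha0 hks hC htab hN h hμ
  rw [hk] at h1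
  exact_mod_cast h1

end Christoffel

end Summit.Ventures.WeilGRH

end
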